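import Literature.AnabelianGeometry.SemiGraphs.LocallyOpenComp
import Literature.AnabelianGeometry.SemiGraphs.SemiGraphLocal

/-!
# Semi-graphs of anabelioids induced along a morphism of semi-graphs ([SemiAnbd] §1 p.13, §4 Def 4.1) — merge step M4, part 1

Mochizuki, *Semi-graphs of anabelioids*, Publ. RIMS **42** (2006), §1 p.13 ("we define morphisms
of semi-graphs `G[v] → G`; `G[e] → G`; `G[b] → G`") and §4 Def 4.1 p.50 ("write `𝒢[v] := 𝒢_{𝔾[v]}`,
`𝒢[e] := 𝒢_{𝔾[e]}`, `𝒢[b] := 𝒢_{𝔾[b]}` … for the result of pulling back the semi-graph of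
anabelioids structure of `𝒢` via these morphisms, we obtain natural morphisms of semi-graphs of
anabelioids `𝒢[v] → 𝒢`; `𝒢[e] → 𝒢`; …") (kurims `paper:url-f33ace170ff4`).
[cite: MochizukiSemiAnbd2006, Def 4.1, p. 50]

CONSTRUCTION (L3 bridge, step M4 part 1; cell ruling abc-iut-L3-lead 2026-08-25T20:36Z): for a
semi-graph of anabelioids `𝒢` (t1's `SemiGraphOfAnabelioids`) and a morphism of semi-graphs
`ι : H ⟶ 𝒢.graph`,

* `𝒢.inducedAlong ι` — the semi-graph of anabelioids on `H` "obtained by pulling back the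
  semi-graph of anabelioids structure of `𝒢` via `ι`": constituents `𝒢_{ι w}`, `𝒢_{ι e}`, branch
  morphisms those of `𝒢` (read along `𝒢.edgeOf (ι c) = ι (H.edgeOf c)` with the transport `idE` of
  `HomComposition.lean`);
* `𝒢.inducedAlongHom ι : Hom (𝒢.inducedAlong ι) 𝒢` — the natural 1-morphism over `ι` (identity
  constituent functors), and `inducedAlongHom_isLocallyOpen` (it is locally open, indeed locally
  trivial: `inducedAlongHom_isLocallyTrivial`).

The localizations `𝒢[v]`, `𝒢[e]`, `𝒢[b]` of Def 4.1 are the instances at t1's `SemiGraph.atVertexHom`,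
`atEdgeHom`, `atBranchHom` (`SemiGraphLocal.lean`): `𝒢.atVertex v`, `𝒢.atEdge e`, `𝒢.atBranch b hb`
with `𝒢.atVertexHom v` etc.  Part 2 (pending): the arrows `𝒢[b] → 𝒢[v]`, `𝒢[b] → 𝒢[e]` over `𝒢`, the
inheritance of total aloofness / verticial slimness (objects of the ambient category `SgA`), and
functoriality in `Aut 𝒢`.  Nothing printed is asserted.
-/

namespace Literature.AnabelianGeometry.SemiGraphs

open CategoryTheory Literature.AnabelianGeometry.Anabelioids

universe v₁ u₁ u

namespace SemiGraphOfAnabelioids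

variable (𝒢 : SemiGraphOfAnabelioids.{v₁, u₁, u}) {H : SemiGraph.{u}} (ι : H ⟶ 𝒢.graph)

/-- **Pull-back of a semi-graph of anabelioids along a morphism of semi-graphs** `ι : H → 𝔾`
(Def 4.1: "the result of pulling back the semi-graph of anabelioids structure of `𝒢` via" `ι`):
underlying semi-graph `H`, constituents `𝒢_{ι w}`, `𝒢_{ι e}`, and for a branch `c` of `e` abutting to
`w` the branch morphism `(ι c)_* : 𝒢_{𝔾.edgeOf (ι c)} → 𝒢_{ι w}` of `𝒢`, read on `𝒢_{ι e}` along
`𝔾.edgeOf (ι c) = ι e`. [cite: MochizukiSemiAnbd2006, Def 4.1, p. 50] -/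
noncomputable abbrev inducedAlong : SemiGraphOfAnabelioids.{v₁, u₁, u} where
  graph := H
  V w := 𝒢.V (ι.vertexMap w)
  E e := 𝒢.E (ι.edgeMap e)
  pull c w h :=
    (𝒢.idE (ι.edgeMap (H.edgeOf c)) (𝒢.graph.edgeOf (ι.branchMap c)) (ι.edgeOf_branchMap c).symm).comp
      (𝒢.pull (ι.branchMap c) (ι.vertexMap w) (ι.abuts_branchMap c w h))

/-- The underlying semi-graph of the pull-back is `H`. [cite: MochizukiSemiAnbd2006, Def 4.1, p. 50] -/
@[simp] theorem inducedAlong_graph : (𝒢.inducedAlong ι).graph = H := rfl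

/-- **The natural 1-morphism `𝒢_H → 𝒢` over `ι`** (Def 4.1: "natural morphisms of semi-graphs of
anabelioids `𝒢[v] → 𝒢`; `𝒢[e] → 𝒢`; `𝒢[b] → 𝒢`"): identity functors on the constituents.
[cite: MochizukiSemiAnbd2006, Def 4.1, p. 50] -/
noncomputable def inducedAlongHomOver : HomOver (𝒢.inducedAlong ι) 𝒢 ι where
  φV w := Anabelioids.Hom.id (𝒢.V (ι.vertexMap w))
  φE e e' h := 𝒢.idE (ι.edgeMap e) e' h
  φB c w h :=
    ((𝒢.pull (ι.branchMap c) (ι.vertexMap w) (ι.abuts_branchMap c w h)).pullback ⋙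
      (𝒢.idE (ι.edgeMap (H.edgeOf c)) (𝒢.graph.edgeOf (ι.branchMap c))
        (ι.edgeOf_branchMap c).symm).pullback).leftUnitor

/-- The natural 1-morphism `𝒢_H → 𝒢` (as a `Hom`). [cite: MochizukiSemiAnbd2006, Def 4.1, p. 50] -/
noncomputable def inducedAlongHom : Hom (𝒢.inducedAlong ι) 𝒢 := (𝒢.inducedAlongHomOver ι).toHom

/-- Its underlying morphism of semi-graphs is `ι`. [cite: MochizukiSemiAnbd2006, Def 4.1, p. 50] -/
@[simp] theorem inducedAlongHom_base : (𝒢.inducedAlongHom ι).base = ι := rfl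

/-- The transported identity `idE` is an isomorphism of anabelioids (an equivalence of categories).
[cite: MochizukiSemiAnbd2006, Rmk 2.4.2, p. 26] -/
theorem idE_isIsomorphism (e e' : 𝒢.graph.Edge) (h : e = e') : (𝒢.idE e e' h).IsIsomorphism := by
  subst h
  change (𝟭 (𝒢.E e)).IsEquivalence
  infer_instance

/-- The natural 1-morphism `𝒢_H → 𝒢` is locally trivial (all constituent morphisms are
isomorphisms). [cite: MochizukiSemiAnbd2006, Def 2.2 (ii), p. 24] -/
theorem inducedAlongHom_isLocallyTrivial : (𝒢.inducedAlongHom ι).IsLocallyTrivial := by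
  refine ⟨fun w => ?_, fun e => 𝒢.idE_isIsomorphism _ _ rfl⟩
  change (𝟭 (𝒢.V (ι.vertexMap w))).IsEquivalence
  infer_instance

/-- `π₁` of a transported identity is surjective. [cite: MochizukiSemiAnbd2006, Rmk 2.4.2, p. 26] -/
theorem pi1Map_idE_surjective (e e' : 𝒢.graph.Edge) (h : e = e') (F : 𝒢.E e ⥤ FintypeCat.{v₁}) :
    Function.Surjective (pi1Map (𝒢.idE e e' h).pullback F) := by
  subst h
  exact pi1Map_id_surjective F

/-- The natural 1-morphism `𝒢_H → 𝒢` is locally open. [cite: MochizukiSemiAnbd2006, Def 2.2 (ii), p. 24] -/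
theorem inducedAlongHom_isLocallyOpen : (𝒢.inducedAlongHom ι).IsLocallyOpen := by
  refine ⟨fun w F _ => ?_, fun e F _ => ?_⟩
  · have : Set.range (pi1Map ((𝒢.inducedAlongHom ι).φV w).pullback F) = Set.univ :=
      Set.range_eq_univ.mpr (pi1Map_id_surjective F)
    rw [this]; exact isOpen_univ
  · have : Set.range (pi1Map ((𝒢.inducedAlongHom ι).φE e ((𝒢.inducedAlongHom ι).base.edgeMap e)
        rfl).pullback F) = Set.univ :=
      Set.range_eq_univ.mpr (𝒢.pi1Map_idE_surjective _ _ rfl F)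
    rw [this]; exact isOpen_univ

/-! ### Functoriality in the semi-graph over `𝔾`: induced 1-morphisms over commutative triangles -/

variable {𝒢} in
/-- The identity 1-morphism of the constituent anabelioid `𝒢_v`, read as `𝒢_v → 𝒢_{v'}` along
`v = v'` (vertex analogue of `idE`). [cite: MochizukiSemiAnbd2006, Rmk 2.4.2, p. 26] -/
noncomputable def idV (v v' : 𝒢.graph.Vertex) (h : v = v') : Anabelioids.Hom (𝒢.V v) (𝒢.V v') := by
  subst h; exact Anabelioids.Hom.id (𝒢.V v)

/-- At `v' = v` the transported identity is the identity. [cite: MochizukiSemiAnbd2006, Rmk 2.4.2, p. 26] -/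
@[simp] theorem idV_rfl (v : 𝒢.graph.Vertex) : 𝒢.idV v v rfl = Anabelioids.Hom.id (𝒢.V v) := rfl

variable {𝒢} in
/-- The 2-cell of the induced 1-morphism over a commutative triangle, over ARBITRARY presentations
(all equalities between vertices / branches / edges of `𝔾` as hypotheses, the branch morphisms as
parameters related by `HEq`; an identity after `subst`). [cite: MochizukiSemiAnbd2006, Def 4.1, p. 50] -/
noncomputable def inducedMapCell (β₁ β₂ : 𝒢.graph.Branch) (hβ : β₁ = β₂) (v₁ v₂ : 𝒢.graph.Vertex)
    (hv : v₁ = v₂) (P : Anabelioids.Hom (𝒢.E (𝒢.graph.edgeOf β₁)) (𝒢.V v₁))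
    (Q : Anabelioids.Hom (𝒢.E (𝒢.graph.edgeOf β₂)) (𝒢.V v₂)) (hPQ : HEq P Q)
    (E₀ E₁ : 𝒢.graph.Edge) (q : E₀ = E₁) (p : E₀ = 𝒢.graph.edgeOf β₁)
    (p' : E₁ = 𝒢.graph.edgeOf β₂) :
    (𝒢.idV v₁ v₂ hv).pullback ⋙ ((𝒢.idE E₀ _ p).comp P).pullback ≅
      ((𝒢.idE E₁ _ p').comp Q).pullback ⋙ (𝒢.idE E₀ E₁ q).pullback := by
  subst hβ; subst hv; subst q; subst p; cases hPQ
  exact (Functor.leftUnitor _) ≪≫ (Functor.rightUnitor _).symm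

variable {𝒢} in
/-- Branch morphisms at equal arguments are `HEq` (bookkeeping for `inducedMapCell`).
[cite: MochizukiSemiAnbd2006, Def 2.1, p. 22] -/
theorem pull_heq (β₁ β₂ : 𝒢.graph.Branch) (hβ : β₁ = β₂) (v₁ v₂ : 𝒢.graph.Vertex) (hv : v₁ = v₂)
    (h₁ : 𝒢.graph.abuts β₁ = some v₁) (h₂ : 𝒢.graph.abuts β₂ = some v₂) :
    HEq (𝒢.pull β₁ v₁ h₁) (𝒢.pull β₂ v₂ h₂) := by
  subst hβ; subst hv; rfl

variable {H' : SemiGraph.{u}}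

/-- **Induced 1-morphism over a commutative triangle** `κ ≫ ι = ι'` of morphisms of semi-graphs
over `𝔾`: the natural `𝒢_{H'} → 𝒢_{H}` over `κ` (identity constituent functors, read along the
equalities the triangle provides) — e.g. `𝒢[b] → 𝒢[v]`, `𝒢[b] → 𝒢[e]` over `𝒢` (§1 p.13, Def 4.1).
[cite: MochizukiSemiAnbd2006, Def 4.1, p. 50] -/
noncomputable def inducedAlongMap (κ : H' ⟶ H) (ι' : H' ⟶ 𝒢.graph) (r : κ ≫ ι = ι') :
    HomOver (𝒢.inducedAlong ι') (𝒢.inducedAlong ι) κ where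
  φV w := 𝒢.idV (ι'.vertexMap w) (ι.vertexMap (κ.vertexMap w)) (by subst r; rfl)
  φE e e' h := 𝒢.idE (ι'.edgeMap e) (ι.edgeMap e') (by subst r; subst h; rfl)
  φB c w hc :=
    inducedMapCell (ι'.branchMap c) (ι.branchMap (κ.branchMap c)) (by subst r; rfl)
      (ι'.vertexMap w) (ι.vertexMap (κ.vertexMap w)) (by subst r; rfl)
      (𝒢.pull (ι'.branchMap c) (ι'.vertexMap w) (ι'.abuts_branchMap c w hc))
      (𝒢.pull (ι.branchMap (κ.branchMap c)) (ι.vertexMap (κ.vertexMap w))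
        (ι.abuts_branchMap _ _ (κ.abuts_branchMap c w hc)))
      (pull_heq _ _ (by subst r; rfl) _ _ (by subst r; rfl) _ _)
      (ι'.edgeMap (H'.edgeOf c)) (ι.edgeMap (H.edgeOf (κ.branchMap c)))
      (by subst r; exact congrArg ι.edgeMap (κ.edgeOf_branchMap c).symm)
      (ι'.edgeOf_branchMap c).symm (ι.edgeOf_branchMap (κ.branchMap c)).symm

/-- `π₁` of a transported vertex identity is surjective. [cite: MochizukiSemiAnbd2006, Rmk 2.4.2, p. 26] -/
theorem pi1Map_idV_surjective (v v' : 𝒢.graph.Vertex) (h : v = v')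
    (F : 𝒢.V v ⥤ FintypeCat.{v₁}) : Function.Surjective (pi1Map (𝒢.idV v v' h).pullback F) := by
  subst h
  exact pi1Map_id_surjective F

/-- The induced 1-morphism over a commutative triangle is locally open.
[cite: MochizukiSemiAnbd2006, Def 2.2 (ii), p. 24] -/
theorem inducedAlongMap_isLocallyOpen (κ : H' ⟶ H) (ι' : H' ⟶ 𝒢.graph) (r : κ ≫ ι = ι') :
    (𝒢.inducedAlongMap ι κ ι' r).toHom.IsLocallyOpen := by
  refine ⟨fun w F _ => ?_, fun e F _ => ?_⟩
  · have : Set.range (pi1Map ((𝒢.inducedAlongMap ι κ ι' r).toHom.φV w).pullback F) = Set.univ :=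
      Set.range_eq_univ.mpr (𝒢.pi1Map_idV_surjective _ _ _ F)
    rw [this]; exact isOpen_univ
  · have : Set.range (pi1Map ((𝒢.inducedAlongMap ι κ ι' r).toHom.φE e
        ((𝒢.inducedAlongMap ι κ ι' r).toHom.base.edgeMap e) rfl).pullback F) = Set.univ :=
      Set.range_eq_univ.mpr (𝒢.pi1Map_idE_surjective _ _ _ F)
    rw [this]; exact isOpen_univ

/-! ### The localizations `𝒢[v]`, `𝒢[e]`, `𝒢[b]` (Def 4.1) -/

/-- `𝒢[v] := 𝒢_{𝔾[v]}`: the localization at a vertex, pulled back along t1's `𝔾[v] → 𝔾`.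
[cite: MochizukiSemiAnbd2006, Def 4.1, p. 50] -/
noncomputable abbrev atVertex (v : 𝒢.graph.Vertex) : SemiGraphOfAnabelioids.{v₁, u₁, u} :=
  𝒢.inducedAlong (𝒢.graph.atVertexHom v)

/-- `𝒢[e] := 𝒢_{𝔾[e]}`: the localization at an edge. [cite: MochizukiSemiAnbd2006, Def 4.1, p. 50] -/
noncomputable abbrev atEdge (e : 𝒢.graph.Edge) : SemiGraphOfAnabelioids.{v₁, u₁, u} :=
  𝒢.inducedAlong (𝒢.graph.atEdgeHom e)

/-- `𝒢[b] := 𝒢_{𝔾[b]}`: the localization at a branch abutting to a vertex.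
[cite: MochizukiSemiAnbd2006, Def 4.1, p. 50] -/
noncomputable abbrev atBranch (b : 𝒢.graph.Branch) (hb : (𝒢.graph.abuts b).isSome) :
    SemiGraphOfAnabelioids.{v₁, u₁, u} :=
  𝒢.inducedAlong (𝒢.graph.atBranchHom b hb)

/-- The natural morphism `𝒢[v] → 𝒢`. [cite: MochizukiSemiAnbd2006, Def 4.1, p. 50] -/
noncomputable def atVertexHom (v : 𝒢.graph.Vertex) : Hom (𝒢.atVertex v) 𝒢 :=
  𝒢.inducedAlongHom (𝒢.graph.atVertexHom v)

/-- The natural morphism `𝒢[e] → 𝒢`. [cite: MochizukiSemiAnbd2006, Def 4.1, p. 50] -/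
noncomputable def atEdgeHom (e : 𝒢.graph.Edge) : Hom (𝒢.atEdge e) 𝒢 :=
  𝒢.inducedAlongHom (𝒢.graph.atEdgeHom e)

/-- The natural morphism `𝒢[b] → 𝒢`. [cite: MochizukiSemiAnbd2006, Def 4.1, p. 50] -/
noncomputable def atBranchHom (b : 𝒢.graph.Branch) (hb : (𝒢.graph.abuts b).isSome) :
    Hom (𝒢.atBranch b hb) 𝒢 :=
  𝒢.inducedAlongHom (𝒢.graph.atBranchHom b hb)

/-- The natural morphism `𝒢[b] → 𝒢[e]` over `𝒢` (§1 p.13, Def 4.1): the triangle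
`(𝔾[b] ↪ 𝔾[e]) ≫ (𝔾[e] → 𝔾) = (𝔾[b] → 𝔾)` commutes by definition.
[cite: MochizukiSemiAnbd2006, Def 4.1, p. 50] -/
noncomputable def atBranchToAtEdge (b : 𝒢.graph.Branch) (hb : (𝒢.graph.abuts b).isSome) :
    Hom (𝒢.atBranch b hb) (𝒢.atEdge (𝒢.graph.edgeOf b)) :=
  (𝒢.inducedAlongMap (𝒢.graph.atEdgeHom (𝒢.graph.edgeOf b)) (𝒢.graph.atBranchToAtEdge b hb)
    (𝒢.graph.atBranchHom b hb) rfl).toHom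

/-- The triangle `(𝔾[b] → 𝔾[v]) ≫ (𝔾[v] → 𝔾) = (𝔾[b] → 𝔾)` of morphisms of semi-graphs commutes
(t1's `SemiGraphLocal.lean` constructions; the vertex of `𝔾[b]` lies over `b`).
[cite: MochizukiSemiAnbd2006, §1, p. 13] -/
theorem _root_.Literature.AnabelianGeometry.SemiGraphs.SemiGraph.atBranchToAtVertex_comp_atVertexHom
    (G : SemiGraph.{u}) (b : G.Branch) (hb : (G.abuts b).isSome) :
    G.atBranchToAtVertex b hb ≫ G.atVertexHom ((G.abuts b).get hb) = G.atBranchHom b hb := by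
  refine SemiGraph.hom_ext _ _ (funext fun w => ?_) (funext fun _ => rfl) (funext fun _ => rfl)
  have hw : w.1 = ⟨b, rfl, hb⟩ := w.2
  change (G.abuts b).get hb = (G.abuts w.1.1).get w.1.2.2
  simp only [hw]

/-- The natural morphism `𝒢[b] → 𝒢[v]` over `𝒢`, for `b` abutting to `v = ζ(b)` (§1 p.13, Def 4.1).
[cite: MochizukiSemiAnbd2006, Def 4.1, p. 50] -/
noncomputable def atBranchToAtVertex (b : 𝒢.graph.Branch) (hb : (𝒢.graph.abuts b).isSome) :
    Hom (𝒢.atBranch b hb) (𝒢.atVertex ((𝒢.graph.abuts b).get hb)) :=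
  (𝒢.inducedAlongMap (𝒢.graph.atVertexHom ((𝒢.graph.abuts b).get hb))
    (𝒢.graph.atBranchToAtVertex b hb) (𝒢.graph.atBranchHom b hb)
    (𝒢.graph.atBranchToAtVertex_comp_atVertexHom b hb)).toHom

/-- `𝒢[b] → 𝒢[e]` is locally open. [cite: MochizukiSemiAnbd2006, Def 4.1, p. 50] -/
theorem atBranchToAtEdge_isLocallyOpen (b : 𝒢.graph.Branch) (hb : (𝒢.graph.abuts b).isSome) :
    (𝒢.atBranchToAtEdge b hb).IsLocallyOpen :=
  𝒢.inducedAlongMap_isLocallyOpen _ _ _ _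

/-- `𝒢[b] → 𝒢[v]` is locally open. [cite: MochizukiSemiAnbd2006, Def 4.1, p. 50] -/
theorem atBranchToAtVertex_isLocallyOpen (b : 𝒢.graph.Branch) (hb : (𝒢.graph.abuts b).isSome) :
    (𝒢.atBranchToAtVertex b hb).IsLocallyOpen :=
  𝒢.inducedAlongMap_isLocallyOpen _ _ _ _

/-- `𝒢[v] → 𝒢` is locally open (an arrow of the ambient category).
[cite: MochizukiSemiAnbd2006, Def 4.1, p. 50] -/
theorem atVertexHom_isLocallyOpen (v : 𝒢.graph.Vertex) : (𝒢.atVertexHom v).IsLocallyOpen :=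
  𝒢.inducedAlongHom_isLocallyOpen _

/-- `𝒢[e] → 𝒢` is locally open. [cite: MochizukiSemiAnbd2006, Def 4.1, p. 50] -/
theorem atEdgeHom_isLocallyOpen (e : 𝒢.graph.Edge) : (𝒢.atEdgeHom e).IsLocallyOpen :=
  𝒢.inducedAlongHom_isLocallyOpen _

/-- `𝒢[b] → 𝒢` is locally open. [cite: MochizukiSemiAnbd2006, Def 4.1, p. 50] -/
theorem atBranchHom_isLocallyOpen (b : 𝒢.graph.Branch) (hb : (𝒢.graph.abuts b).isSome) :
    (𝒢.atBranchHom b hb).IsLocallyOpen :=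
  𝒢.inducedAlongHom_isLocallyOpen _

/-- The vertex anabelioid of `𝒢[v]` at its unique vertex is `𝒢_v`.
[cite: MochizukiSemiAnbd2006, Def 4.1, p. 50] -/
@[simp] theorem atVertex_V (v : 𝒢.graph.Vertex) (w : (𝒢.graph.atVertex v).Vertex) :
    (𝒢.atVertex v).V w = 𝒢.V v := rfl

/-- Verticial slimness is inherited by `𝒢[v]` (its only vertex anabelioid is `𝒢_v`).
[cite: MochizukiSemiAnbd2006, Def 2.4 (ii), p. 25] -/
theorem atVertex_isVerticiallySlim (h : 𝒢.IsVerticiallySlim) (v : 𝒢.graph.Vertex) :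
    (𝒢.atVertex v).IsVerticiallySlim :=
  ⟨fun _ => h.isSlim v⟩

/-- Verticial slimness is inherited by `𝒢[e]` (vertex anabelioids `𝒢_{v_b}`).
[cite: MochizukiSemiAnbd2006, Def 2.4 (ii), p. 25] -/
theorem atEdge_isVerticiallySlim (h : 𝒢.IsVerticiallySlim) (e : 𝒢.graph.Edge) :
    (𝒢.atEdge e).IsVerticiallySlim :=
  ⟨fun _ => h.isSlim _⟩

/-- Verticial slimness is inherited by `𝒢[b]`. [cite: MochizukiSemiAnbd2006, Def 2.4 (ii), p. 25] -/
theorem atBranch_isVerticiallySlim (h : 𝒢.IsVerticiallySlim) (b : 𝒢.graph.Branch)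
    (hb : (𝒢.graph.abuts b).isSome) : (𝒢.atBranch b hb).IsVerticiallySlim :=
  ⟨fun _ => h.isSlim _⟩

/-! ### Every edge of a localization abuts to a vertex ([IUTchI] Rmk 2.5.3 (iii) hypothesis) -/

/-- In `𝒢[v]` every edge abuts to the vertex (through its branch lying over the branch it indexes).
[cite: MochizukiSemiAnbd2006, §1, p. 13] -/
theorem atVertex_everyEdgeAbuts (v : 𝒢.graph.Vertex) : (𝒢.atVertex v).EveryEdgeAbuts := by
  intro p
  refine ⟨⟨(p, p.1), rfl⟩, PUnit.unit, rfl, ?_⟩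
  exact (𝒢.graph.atVertex_abuts_eq_some_iff v _ _).mpr rfl

/-- In `𝒢[e]` the edge abuts to a vertex as soon as `e` does in `𝔾`.
[cite: MochizukiSemiAnbd2006, §1, p. 13] -/
theorem atEdge_everyEdgeAbuts (h : 𝒢.EveryEdgeAbuts) (e : 𝒢.graph.Edge) :
    (𝒢.atEdge e).EveryEdgeAbuts := by
  intro _
  obtain ⟨b, w, hb, hw⟩ := h e
  have hs : (𝒢.graph.abuts b).isSome := by rw [hw]; rfl
  exact ⟨⟨b, hb⟩, ⟨b, hb, hs⟩, rfl, (𝒢.graph.atEdge_abuts_eq_some_iff e _ _).mpr rfl⟩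

/-- In `𝒢[b]` the edge abuts to the vertex (through the branch over `b`).
[cite: MochizukiSemiAnbd2006, §1, p. 13] -/
theorem atBranch_everyEdgeAbuts (b : 𝒢.graph.Branch) (hb : (𝒢.graph.abuts b).isSome) :
    (𝒢.atBranch b hb).EveryEdgeAbuts := by
  intro _
  refine ⟨⟨⟨b, rfl⟩, Set.mem_univ _⟩, ⟨⟨b, rfl, hb⟩, rfl⟩, rfl, ?_⟩
  exact (𝒢.graph.atBranch_abuts_eq_some_iff b hb _ _).mpr rfl

end SemiGraphOfAnabelioids

end Literature.AnabelianGeometry.SemiGraphs
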